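import Mathlib
import Summits.Ventures.HodgeRepro.Tier4.Common.RowPlane
import Summits.Ventures.HodgeRepro.Tier4.Common.MixedPlaneKType
import Summits.Ventures.HodgeRepro.Tier4.Line1.PlaneDefs

/-!
# Tier4/Line4/SeesawDefinite — L1's `IsDefinite` for the mixed row plane (and any transported-torus plane over it)
from ONE real place where the two lines have OPPOSITE signs: the displayed clause of the weak W5 on LINE L4's seesaw
plane as a sign condition on the face datum

Blind re-derivation cell `pub-hodge-repro`, Tier 4 «prove the step» (README §9–§10), seat t4-L4-p2 (gen 2; LINE L4).
Tree path `lean/Summits/Ventures/HodgeRepro/Tier4/Line4/SeesawDefinite.lean`.  Imports typer-2's `Common/RowPlane`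
(`lineGramRow`, `PlaneData.mixedRow`, `blockDiag4`, `re4`), `Common/MixedPlaneKType` (`withTransportedTorus`) and L1's
`Line1/PlaneDefs` (`IsDefinite`).

THE STATEMENT.  With `q.t = 0`, `lineGramRow q a = a • diag(2n, 2)`, so the Gram matrix of the mixed row plane
`⟨a⟩ ⊕ ⟨−b⟩` is `diag(2an, 2a, −2bn, −2b)` (reindexed); under a real embedding `σ` of `k` it is positive definite iff
`σ(a) > 0`, `σ(n) > 0`, `σ(b) < 0`, and negative definite iff the opposite signs — i.e. (with `σ(n) > 0`, which holds at
every real place of `k` when `E′ = k(√−n)` is CM) iff `σ(a)` and `σ(b)` have OPPOSITE signs.  `isDefinite_mixedRow_of_signs`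
proves `IsDefinite (mixedRow q a b)` from `0 < σ n` and `σ a * σ b < 0`; `isDefinite_withTransportedTorus` transports it
to any plane with a transported second torus (same `B`).  Read on LINE L4 (plan-4's L4-MATH.md §5 (A)): the seesaw
plane `⟨a₀⟩ ⊕ ⟨−a₂⟩` has signature `(1,1)` at `w₀` (same signs, `_hpos`), and is definite at a real place `w ≠ w₀` iff
the face's sign pattern there is `(1,0,1,0)` / `(0,1,0,1)` — so the weak W5's `IsDefinite` clause is exactly «some
real place of `k` where the lines `a₀`, `a₂` have opposite signs», a lookup in the seesaw datum.  Nothing here is about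
the wall's truth.  HC_CM is NOT proved by anyone in this repository.
-/

set_option autoImplicit false

noncomputable section

namespace Summit.Ventures.HodgeRepro.Tier4.Line4

open Matrix Summit.Ventures.HodgeRepro.Tier4.Common Summit.Ventures.HodgeRepro.Tier4.Line1

section Definite

variable {k : Type} [Field k]

/-- `lineGramRow q a` at `t = 0` is the diagonal matrix `diag(2an, 2a)`. -/
theorem lineGramRow_eq_diagonal (q : QuadData k) (ht : q.t = 0) (a : k) :
    lineGramRow q a = diagonal ![2 * a * q.n, 2 * a] := by
  ext i j; fin_cases i <;> fin_cases j <;> simp [lineGramRow, ht, diagonal] <;> ring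

/-- The Gram matrix of the mixed row plane at `t = 0`, as a reindexed diagonal matrix. -/
theorem mixedRow_B_eq (q : QuadData k) (ht : q.t = 0) (a b : k) :
    (PlaneData.mixedRow q a b).B =
      (diagonal (Sum.elim ![2 * a * q.n, 2 * a] ![-(2 * b * q.n), -(2 * b)])).reindex finSumFinEquiv finSumFinEquiv := by
  show blockDiag4 (lineGramRow q a) ((-1 : k) • lineGramRow q b) = _
  have hneg : (-1 : k) • lineGramRow q b = diagonal ![-(2 * b * q.n), -(2 * b)] := by
    rw [lineGramRow_eq_diagonal q ht, ← diagonal_smul]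
    congr 1
    ext i; fin_cases i <;> simp
  rw [lineGramRow_eq_diagonal q ht, hneg]
  simp only [blockDiag4, re4, coe_reindexAlgEquiv, fromBlocks_diagonal]

/-- The real Gram matrix under `σ` is the reindexed diagonal of the images. -/
theorem mixedRow_B_map (q : QuadData k) (ht : q.t = 0) (a b : k) (σ : k →+* ℝ) :
    ((PlaneData.mixedRow q a b).B).map σ =
      (diagonal (Sum.elim ![2 * σ a * σ q.n, 2 * σ a] ![-(2 * σ b * σ q.n), -(2 * σ b)])).reindex
        finSumFinEquiv finSumFinEquiv := by
  rw [mixedRow_B_eq q ht a b]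
  simp only [reindex_apply, ← submatrix_map, diagonal_map (map_zero σ)]
  congr 2
  ext i
  rcases i with i | i <;> fin_cases i <;> simp [map_mul, map_neg, map_ofNat]

/-- **`IsDefinite` of the mixed row plane from a real place where the lines have opposite signs** (`σ n > 0`). -/
theorem isDefinite_mixedRow_of_signs (q : QuadData k) (ht : q.t = 0) (a b : k) (σ : k →+* ℝ) (hn : 0 < σ q.n)
    (hab : σ a * σ b < 0) : IsDefinite (PlaneData.mixedRow q a b) := by
  refine ⟨σ, ?_⟩
  rw [mixedRow_B_map q ht a b σ]
  rcases lt_or_gt_of_ne (show σ a ≠ 0 from fun h => by simp [h] at hab) with ha | ha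
  · -- `σ a < 0`, hence `σ b > 0`: negative definite
    have hb : 0 < σ b := by
      by_contra hb'
      exact absurd hab (not_lt.mpr (mul_nonneg_of_nonpos_of_nonpos ha.le (not_lt.mp hb')))
    right
    have key : -((diagonal (Sum.elim ![2 * σ a * σ q.n, 2 * σ a] ![-(2 * σ b * σ q.n), -(2 * σ b)])).reindex
        finSumFinEquiv finSumFinEquiv) =
        (diagonal (-(Sum.elim ![2 * σ a * σ q.n, 2 * σ a] ![-(2 * σ b * σ q.n), -(2 * σ b)]))).reindex
          finSumFinEquiv finSumFinEquiv := by
      ext i j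
      simp only [reindex_apply, Matrix.neg_apply, Matrix.submatrix_apply, Matrix.diagonal_apply, Pi.neg_apply]
      split_ifs <;> simp
    rw [key, reindex_apply]
    refine Matrix.PosDef.submatrix ?_ finSumFinEquiv.symm.injective
    rw [posDef_diagonal_iff]
    intro i
    rcases i with i | i <;> fin_cases i <;> simp <;> nlinarith
  · -- `σ a > 0`, hence `σ b < 0`: positive definite
    have hb : σ b < 0 := by
      by_contra hb'
      exact absurd hab (not_lt.mpr (mul_nonneg ha.le (not_lt.mp hb')))
    left
    rw [reindex_apply]
    refine Matrix.PosDef.submatrix ?_ finSumFinEquiv.symm.injective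
    rw [posDef_diagonal_iff]
    intro i
    rcases i with i | i <;> fin_cases i <;> simp <;> nlinarith

/-- Transporting the second torus does not change `B`, hence not `IsDefinite`. -/
theorem isDefinite_withTransportedTorus (W : PlaneData k) (g g' : Matrix (Fin 4) (Fin 4) k) (hgg' : g * g' = 1)
    (hg'g : g' * g = 1) (hgΩ : g * W.Ω = W.Ω * g) (hW : IsDefinite W) :
    IsDefinite (W.withTransportedTorus g g' hgg' hg'g hgΩ) := hW

/-- **`IsDefinite` on LINE L4's seesaw plane** from a real place where `a 0` and `a 2` have opposite signs. -/
theorem isDefinite_seesawPlane_of_signs (q : QuadData k) (ht : q.t = 0) (a : Fin 4 → k)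
    (g g' : Matrix (Fin 4) (Fin 4) k) (hgg' : g * g' = 1) (hg'g : g' * g = 1)
    (hgΩ : g * (PlaneData.mixedRow q (a 0) (a 2)).Ω = (PlaneData.mixedRow q (a 0) (a 2)).Ω * g)
    (σ : k →+* ℝ) (hn : 0 < σ q.n) (hab : σ (a 0) * σ (a 2) < 0) :
    IsDefinite ((PlaneData.mixedRow q (a 0) (a 2)).withTransportedTorus g g' hgg' hg'g hgΩ) :=
  isDefinite_withTransportedTorus _ g g' hgg' hg'g hgΩ (isDefinite_mixedRow_of_signs q ht (a 0) (a 2) σ hn hab)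

end Definite

end Summit.Ventures.HodgeRepro.Tier4.Line4

end
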